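import Summits.QuantumFields.YangMills.Theorems.BalabanUVNodesN21GibbsBlockSupHazard

/-!
# N21 (NE7c) · transversal tested variables: the windowed hazard bound for `u = φ(ξ)` with slope `≥ κ` along a
# Gibbs fibre, and (M1) for the block-sup of transversally-read, Gibbs-coupled coordinates — constant `2e·Λ·θ∕κ`

R134 seat pub-ymgap-dag-n21-d (g8), node N21 = NE7c (single-run shell-weight bound, NOT PRINTED in [Bałaban 1983–89],
NOT proved), lane K3⁷ `SpineGivenEndpointR13SepCoPH` (stmt-QuantumFields-20544, `--kind proof --supports … --as helper`).
Part 10 of the comparison series; consumes parts 7–9 and `T4ShellMeasure`'s device (b) `preimage_window_subset_Icc`.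

WHAT THIS FILE IS.  Part 9 treated tested variables that ARE coordinates.  Device (b) of `T4ShellMeasure`
(`slotAntiConcentration_of_transversal`) reads the tested variable along a real fibre coordinate `ξ` through a map `φ`
of slope `≥ κ > 0` and converts a density BOUND into an ABSOLUTE window bound.  This file is its RELATIVE version and
its knit with parts 7–9:
* §1 `setLIntegral_le_of_nonCollapse_into`: part 8 §1 generalised — if `f(x) ≤ M·f(y)` for `y ∈ [x, x + δ]`, `x ∈ S`,
  and these right-neighbourhoods stay inside `T`, then `∫_S f ≤ M·|S|∕δ · ∫_T f`.
* §2 `withDensity_preimage_Ico_le_of_transversal`: for `φ` with slope `≥ κ`, the shell `φ⁻¹[a, b)` has length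
  `≤ 2(b − a)∕κ` (device (b), CITED) and its right-neighbourhoods lie in `φ⁻¹[a, ∞)` (monotonicity), so a density
  `e^{−W}` with one-sided slope `≤ Λ` gives `μ(φ⁻¹[a,b)) ≤ 2e·Λ·(b − a)∕κ · μ(φ⁻¹[a, ∞))` — the windowed hazard bound
  for the LAW OF `φ`, i.e. part 7 §3's hypothesis for a transversally-read coordinate.
* §3 KNIT: Gibbs-coupled coordinates `ν = e^{−A} dx` (part 9's uniform partial-slope bound `Λ`), each tested through
  its own transversal reading `u_p = φ_p(x_p)` (slope `≥ κ`): the sub-level events of the other tested variables do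
  not read `x_p`, part 9 §1 integrates the fibre bound, part 7 §2 sums:
  `T4ShellMeasure.SlotAntiConcentration ν (x ↦ ⨆ p, φ_p(x_p)) θ ρ (2e·Λ·θ∕κ)`.

READING FOR THE WALL (hedged; nothing claimed for Bałaban's measure).  `Λ∕κ` is the slope of the fibre action per
unit of the TESTED variable; what is still not modelled: a tested variable reading SEVERAL coordinates (the minimiser
couples them — lens Sketch-g12 §M (M-c) «weak dependence is an enlarged shell» is the typed remedy), group-valued
fibres, own-variable characteristic functions at nearby thresholds, histories.

HONEST FRAMING.  [textbook] real analysis ∕ measure theory; 0 def, 0 sorry; NE7c NOT PRINTED ∕ NOT proved; N21 NOT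
discharged; counts unmoved (typed 28∕28 · discharged 5∕27); count-neutral; one finite 𝕋⁴ at fixed ε — nothing about
ℝ⁴ ∕ OS ∕ mass gap ∕ Clay.
-/

open MeasureTheory Set Function
open scoped ENNReal NNReal

namespace Summit.QuantumFields.YangMills.Theorems.N21TransversalGibbsHazard

open Literature.MathematicalPhysics.QuantumFieldTheory.Balaban1983to89.T4ShellMeasure
  (SlotAntiConcentration preimage_window_subset_Icc)
open Summit.QuantumFields.YangMills.Theorems.N21FirstExceedanceHazard (measure_shell_iSup_le_of_condHazard)
open Summit.QuantumFields.YangMills.Theorems.N21HazardFromLogLipschitz (nonCollapse_of_logLipschitz)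
open Summit.QuantumFields.YangMills.Theorems.N21GibbsBlockSupHazard (measure_coordSlice_le_of_fibrewise)

/-! ## §1 Non-collapse into a target set -/

/-- **NON-COLLAPSE INTO `T`.**  `f(x) ≤ M·f(y)` for `x ∈ S`, `y ∈ [x, x + δ] ⊆ T` (`δ > 0`) ⇒
`∫_S f ≤ M · |S|∕δ · ∫_T f` (Lebesgue). [textbook] -/
theorem setLIntegral_le_of_nonCollapse_into {f : ℝ → ℝ≥0∞} (hf : Measurable f) {S T : Set ℝ}
    (hS : MeasurableSet S) {δ : ℝ} (hδ : 0 < δ) (M : ℝ≥0∞) (hT : ∀ x ∈ S, Icc x (x + δ) ⊆ T)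
    (h : ∀ x ∈ S, ∀ y ∈ Icc x (x + δ), f x ≤ M * f y) :
    ∫⁻ x in S, f x ≤ M * (volume S * (ENNReal.ofReal δ)⁻¹) * ∫⁻ y in T, f y := by
  set I := ∫⁻ y in T, f y with hI
  have hδ0 : ENNReal.ofReal δ ≠ 0 := (ENNReal.ofReal_pos.2 hδ).ne'
  have hδtop : ENNReal.ofReal δ ≠ ⊤ := ENNReal.ofReal_ne_top
  have hpt : ∀ x ∈ S, f x ≤ (ENNReal.ofReal δ)⁻¹ * (M * I) := by
    intro x hx
    have h1 : ENNReal.ofReal δ * f x ≤ M * I := by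
      calc ENNReal.ofReal δ * f x = ∫⁻ _ in Icc x (x + δ), f x := by
            rw [setLIntegral_const, Real.volume_Icc, mul_comm]
            congr 2
            ring
        _ ≤ ∫⁻ y in Icc x (x + δ), M * f y := setLIntegral_mono' measurableSet_Icc fun y hy => h x hx y hy
        _ = M * ∫⁻ y in Icc x (x + δ), f y := lintegral_const_mul M hf
        _ ≤ M * I := mul_le_mul_right (lintegral_mono_set (hT x hx)) _
    calc f x = (ENNReal.ofReal δ)⁻¹ * (ENNReal.ofReal δ * f x) := by
          rw [← mul_assoc, ENNReal.inv_mul_cancel hδ0 hδtop, one_mul]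
      _ ≤ (ENNReal.ofReal δ)⁻¹ * (M * I) := mul_le_mul_right h1 _
  calc ∫⁻ x in S, f x ≤ ∫⁻ _ in S, (ENNReal.ofReal δ)⁻¹ * (M * I) := setLIntegral_mono' hS hpt
    _ = (ENNReal.ofReal δ)⁻¹ * (M * I) * volume S := by rw [setLIntegral_const]
    _ = M * (volume S * (ENNReal.ofReal δ)⁻¹) * I := by ring

/-! ## §2 The windowed hazard bound for a transversally-read variable `u = φ(ξ)` -/

/-- for `φ` with slope `≥ κ > 0`, the shell `φ⁻¹[a, b)` has Lebesgue measure `≤ 2(b − a)∕κ`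
(`T4ShellMeasure.preimage_window_subset_Icc`, CITED). [folklore] -/
theorem volume_preimage_Ico_le {φ : ℝ → ℝ} {κ : ℝ} (hκ : 0 < κ)
    (hslope : ∀ x y, x ≤ y → κ * (y - x) ≤ φ y - φ x) (a b : ℝ) :
    volume (φ ⁻¹' Ico a b) ≤ ENNReal.ofReal (2 * (b - a) / κ) := by
  by_cases hne : (φ ⁻¹' Ico a b).Nonempty
  · obtain ⟨x₀, hx₀⟩ := hne
    have hab : Ico a b = Ico a (a + (b - a)) := by rw [add_sub_cancel]
    have hx₀' : φ x₀ ∈ Ico a (a + (b - a)) := by rwa [← hab]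
    have hsub := preimage_window_subset_Icc hκ hslope (c := a) (δ := b - a) (x₀ := x₀) hx₀'
    rw [← hab] at hsub
    refine (measure_mono hsub).trans ?_
    rw [Real.volume_Icc]
    exact le_of_eq (by congr 1; ring)
  · rw [not_nonempty_iff_eq_empty.1 hne, measure_empty]
    exact bot_le

/-- right-neighbourhoods of the shell stay in the exceedance set: `x ∈ φ⁻¹[a, b)`, `x ≤ y` ⇒ `a ≤ φ y`
(monotonicity from the slope bound). [folklore] -/
theorem Icc_subset_preimage_Ici {φ : ℝ → ℝ} {κ : ℝ} (hκ : 0 < κ)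
    (hslope : ∀ x y, x ≤ y → κ * (y - x) ≤ φ y - φ x) {a b δ x : ℝ} (hx : x ∈ φ ⁻¹' Ico a b) :
    Icc x (x + δ) ⊆ φ ⁻¹' Ici a := by
  intro y hy
  have h1 := hslope x y hy.1
  have h2 : 0 ≤ κ * (y - x) := mul_nonneg hκ.le (by linarith [hy.1])
  simp only [mem_preimage, mem_Ico, mem_Ici] at hx ⊢
  linarith [hx.1]

/-- **WINDOWED HAZARD FOR A TRANSVERSALLY-READ VARIABLE.**  Density `e^{−W}` on the fibre (`W` measurable, one-sided
slope `≤ Λ`, `Λ > 0`, on the right `Λ⁻¹`-neighbourhoods of the shell), reading `φ` measurable with slope `≥ κ > 0`,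
`a ≤ b`: `μ(φ⁻¹[a, b)) ≤ 2e·Λ·(b − a)∕κ · μ(φ⁻¹[a, ∞))` (§1 with `T = φ⁻¹[a, ∞)`, part 8's
`nonCollapse_of_logLipschitz`, device (b)'s length bound). [textbook] -/
theorem withDensity_preimage_Ico_le_of_transversal {W φ : ℝ → ℝ} (hWm : Measurable W) (hφ : Measurable φ)
    {κ Λ a b : ℝ} (hκ : 0 < κ) (hΛ : 0 < Λ) (hab : a ≤ b)
    (hslope : ∀ x y, x ≤ y → κ * (y - x) ≤ φ y - φ x)
    (hW : ∀ x ∈ φ ⁻¹' Ico a b, ∀ y ∈ Icc x (x + Λ⁻¹), W y - W x ≤ Λ * (y - x)) :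
    volume.withDensity (fun x => ENNReal.ofReal (Real.exp (-W x))) (φ ⁻¹' Ico a b)
      ≤ ENNReal.ofReal (2 * Real.exp 1 * Λ * (b - a) / κ)
        * volume.withDensity (fun x => ENNReal.ofReal (Real.exp (-W x))) (φ ⁻¹' Ici a) := by
  have hf : Measurable fun x => ENNReal.ofReal (Real.exp (-W x)) :=
    ENNReal.measurable_ofReal.comp (Real.measurable_exp.comp hWm.neg)
  have hS : MeasurableSet (φ ⁻¹' Ico a b) := hφ measurableSet_Ico
  have hT : MeasurableSet (φ ⁻¹' Ici a) := hφ measurableSet_Ici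
  rw [withDensity_apply _ hS, withDensity_apply _ hT]
  have h1 := setLIntegral_le_of_nonCollapse_into hf hS (inv_pos.2 hΛ) (ENNReal.ofReal (Real.exp (Λ * Λ⁻¹)))
    (fun x hx => Icc_subset_preimage_Ici hκ hslope hx) (nonCollapse_of_logLipschitz hΛ.le hW)
  rw [mul_inv_cancel₀ hΛ.ne', ENNReal.ofReal_inv_of_pos hΛ, inv_inv] at h1
  refine h1.trans (mul_le_mul_left ?_ _)
  have hv := volume_preimage_Ico_le hκ hslope a b
  have h2 : 0 ≤ 2 * (b - a) / κ := div_nonneg (by linarith) hκ.le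
  calc ENNReal.ofReal (Real.exp 1) * (volume (φ ⁻¹' Ico a b) * ENNReal.ofReal Λ)
      ≤ ENNReal.ofReal (Real.exp 1) * (ENNReal.ofReal (2 * (b - a) / κ) * ENNReal.ofReal Λ) := by gcongr
    _ = ENNReal.ofReal (2 * Real.exp 1 * Λ * (b - a) / κ) := by
        rw [← ENNReal.ofReal_mul h2, ← ENNReal.ofReal_mul (Real.exp_pos 1).le]
        congr 1
        ring

/-- … as the windowed hazard bound for the LAW OF `φ` (part 7 §3's hypothesis shape for a transversally-read
coordinate): `(μ.map φ)[a, b) ≤ 2e·Λ·(b − a)∕κ · (μ.map φ)[a, ∞)`. [textbook] -/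
theorem map_withDensity_Ico_le_of_transversal {W φ : ℝ → ℝ} (hWm : Measurable W) (hφ : Measurable φ)
    {κ Λ a b : ℝ} (hκ : 0 < κ) (hΛ : 0 < Λ) (hab : a ≤ b)
    (hslope : ∀ x y, x ≤ y → κ * (y - x) ≤ φ y - φ x)
    (hW : ∀ x ∈ φ ⁻¹' Ico a b, ∀ y ∈ Icc x (x + Λ⁻¹), W y - W x ≤ Λ * (y - x)) :
    (volume.withDensity fun x => ENNReal.ofReal (Real.exp (-W x))).map φ (Ico a b)
      ≤ ENNReal.ofReal (2 * Real.exp 1 * Λ * (b - a) / κ)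
        * (volume.withDensity fun x => ENNReal.ofReal (Real.exp (-W x))).map φ (Ici a) := by
  rw [Measure.map_apply hφ measurableSet_Ico, Measure.map_apply hφ measurableSet_Ici]
  exact withDensity_preimage_Ico_le_of_transversal hWm hφ hκ hΛ hab hslope hW

/-! ## §3 Knit: transversally-read, Gibbs-coupled coordinates -/

section Knit

variable {ι : Type*} [Fintype ι] [DecidableEq ι] [Nonempty ι]

/-- **(M1) FOR THE BLOCK-SUP OF TRANSVERSALLY-READ, GIBBS-COUPLED COORDINATES, constant `2e·Λ·θ∕κ`.**
`ν = e^{−A(x)} dx` on `ℝ^ι`, `A` ANY measurable coupling with one-sided partial slope `≤ Λ` (`Λ > 0`) along each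
coordinate on the right `Λ⁻¹`-neighbourhoods of that coordinate's shell, uniformly in the others; tested variables
`u_p = φ_p(x_p)`, `φ_p` measurable with slope `≥ κ > 0`; `θ, ρ ≥ 0`:
`T4ShellMeasure.SlotAntiConcentration ν (x ↦ ⨆ p, φ_p(x_p)) θ ρ (2e·Λ·θ∕κ)` — no independence, no Gaussian, no
dependence on the number of variables (part 9 §1 per fibre + part 7 §2). [textbook] -/
theorem slotAntiConcentration_iSup_transversal_gibbs {A : (ι → ℝ) → ℝ} (hA : Measurable A) {φ : ι → ℝ → ℝ}
    (hφ : ∀ p, Measurable (φ p)) {κ Λ θ ρ : ℝ} (hκ : 0 < κ) (hΛ : 0 < Λ) (hθ : 0 ≤ θ) (hρ : 0 ≤ ρ)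
    (hslopeφ : ∀ p x y, x ≤ y → κ * (y - x) ≤ φ p y - φ p x)
    (hslopeA : ∀ p, ∀ x : ι → ℝ, ∀ y₁ ∈ φ p ⁻¹' Ico (θ * (1 - ρ)) θ, ∀ y₂ ∈ Icc y₁ (y₁ + Λ⁻¹),
      A (update x p y₂) - A (update x p y₁) ≤ Λ * (y₂ - y₁)) :
    SlotAntiConcentration
      ((Measure.pi fun _ : ι => (volume : Measure ℝ)).withDensity fun x => ENNReal.ofReal (Real.exp (-A x)))
      (fun x => ⨆ p, φ p (x p)) θ ρ (2 * Real.exp 1 * Λ * θ / κ) := by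
  have hab : θ * (1 - ρ) ≤ θ := by nlinarith
  have hg : Measurable fun x : ι → ℝ => ENNReal.ofReal (Real.exp (-A x)) :=
    ENNReal.measurable_ofReal.comp (Real.measurable_exp.comp hA.neg)
  unfold SlotAntiConcentration
  have hmain := measure_shell_iSup_le_of_condHazard
    ((Measure.pi fun _ : ι => (volume : Measure ℝ)).withDensity fun x => ENNReal.ofReal (Real.exp (-A x)))
    (fun p (x : ι → ℝ) => φ p (x p)) (θ * (1 - ρ)) θ (fun p => (hφ p).comp (measurable_pi_apply p))
    (ENNReal.ofReal (2 * Real.exp 1 * Λ * (θ - θ * (1 - ρ)) / κ)) ?_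
  · rw [show 2 * Real.exp 1 * Λ * (θ - θ * (1 - ρ)) / κ = 2 * Real.exp 1 * Λ * θ / κ * ρ by ring] at hmain
    exact hmain.trans (mul_le_mul_right (measure_mono (subset_univ _)) _)
  intro p s _
  set t : ι → ℝ := fun q => if q ∈ s then θ * (1 - ρ) else θ with ht
  -- the sub-level event of the OTHER tested variables does not read `x_p`
  have hC : MeasurableSet {x : ι → ℝ | ∀ q, q ≠ p → φ q (x q) < t q} := by
    have : {x : ι → ℝ | ∀ q, q ≠ p → φ q (x q) < t q} = ⋂ q, {x | q ≠ p → φ q (x q) < t q} := by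
      ext x; simp only [mem_setOf_eq, mem_iInter]
    rw [this]
    refine MeasurableSet.iInter fun q => ?_
    by_cases hq : q = p
    · have : {x : ι → ℝ | q ≠ p → φ q (x q) < t q} = univ := by
        ext x; simp [hq]
      rw [this]; exact MeasurableSet.univ
    · have : {x : ι → ℝ | q ≠ p → φ q (x q) < t q} = {x | φ q (x q) < t q} := by
        ext x; simp [hq]
      rw [this]; exact measurableSet_lt ((hφ q).comp (measurable_pi_apply q)) measurable_const
  have hCp : ∀ (x : ι → ℝ) (y : ℝ),
      update x p y ∈ {x : ι → ℝ | ∀ q, q ≠ p → φ q (x q) < t q}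
        ↔ x ∈ {x : ι → ℝ | ∀ q, q ≠ p → φ q (x q) < t q} := by
    intro x y
    simp only [mem_setOf_eq]
    refine forall_congr' fun q => forall_congr' fun hq => ?_
    rw [update_of_ne hq]
  -- the `p`-fibre through `x`: part 10 §2 with `W = A(x with x_p := ·)`
  have hfib : ∀ x : ι → ℝ, ∫⁻ y in φ p ⁻¹' Ico (θ * (1 - ρ)) θ, ENNReal.ofReal (Real.exp (-A (update x p y)))
      ≤ ENNReal.ofReal (2 * Real.exp 1 * Λ * (θ - θ * (1 - ρ)) / κ)
        * ∫⁻ y in φ p ⁻¹' Ici (θ * (1 - ρ)), ENNReal.ofReal (Real.exp (-A (update x p y))) := by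
    intro x
    have hW : Measurable fun y => A (update x p y) := hA.comp (measurable_update x)
    have h := withDensity_preimage_Ico_le_of_transversal hW (hφ p) hκ hΛ hab (hslopeφ p)
      (fun y₁ hy₁ y₂ hy₂ => hslopeA p x y₁ hy₁ y₂ hy₂)
    rwa [withDensity_apply _ ((hφ p) measurableSet_Ico), withDensity_apply _ ((hφ p) measurableSet_Ici)] at h
  exact measure_coordSlice_le_of_fibrewise hg p ((hφ p) measurableSet_Ico) ((hφ p) measurableSet_Ici) _
    ENNReal.ofReal_ne_top hfib hC hCp

end Knit

end Summit.QuantumFields.YangMills.Theorems.N21TransversalGibbsHazard
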